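import Literature.MathematicalPhysics.QuantumManyBody.PeriodicClusteringFromKyFanGap
import HarnessLib

/-!
# Gram–Schmidt with energy control for nearly orthonormal pairs (line `third-law-current-floor`,
# crux `HardCoreExtension`, stmt-AtomisticToContinuum-11786; Q1 of the (α'₂) pair programme)

Two `C¹` periodic Bose-symmetric functions `u₁, u₂` on `(ℝ³)^N` with cell masses in `[1-η, 1+η]` and
overlap `|⟨u₁,u₂⟩_cell| ≤ η ≤ 1/8` are orthonormalised into two periodic trial states `Ψ₁ = a₁u₁`,
`Ψ₂ = a₂(u₂ - ⟨Ψ₁,u₂⟩Ψ₁)` whose total `w`-energy is at most `(1 + 32η)` times the total unnormalised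
`w`-energy `q_w(u₁) + q_w(u₂)`, `q_w(u) = ∫_cell |∇u|² + W|u|²`, for EVERY measurable pair potential
`w : ℝ → [0,∞]` (hard cores included: all energies are `ℝ≥0∞`-valued). The energy of the difference is
controlled by the pointwise, division-free Young inequality
`|z₁ - cz₂|² ≤ (1+η)|z₁|² + K²(η+η²)|z₂|²` for `|c| ≤ Kη` (applied to values and to partial
derivatives), the mass of `u₂ - ⟨Ψ₁,u₂⟩Ψ₁` from below by the same inequality, and the scaling law
`q(cu) = |c|²q(u)`. [folklore]
-/

noncomputable section

namespace Summit.AtomisticToContinuum.BoseEinsteinCondensation.Cruxes.HardCoreExtension.ThirdLawCurrentFloor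

open MeasureTheory Filter
open scoped ENNReal NNReal BigOperators Topology ComplexConjugate
open Literature.MathematicalPhysics.QuantumManyBody.BoseGas

namespace GramSchmidtPair

variable {N : ℕ} {L : ℝ} {v : ℝ → ℝ≥0∞}

/-! ### Pointwise Young inequalities -/

/-- Division-free Young inequality in `ℂ`: `‖z₁ - c z₂‖² ≤ (1+η)‖z₁‖² + K²(η+η²)‖z₂‖²` whenever
`‖c‖ ≤ Kη`, `η ≥ 0`. [folklore] -/
theorem norm_sub_mul_sq_le (z₁ z₂ c : ℂ) {K η : ℝ} (hη : 0 ≤ η) (hc : ‖c‖ ≤ K * η) :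
    ‖z₁ - c * z₂‖ ^ 2 ≤ (1 + η) * ‖z₁‖ ^ 2 + K ^ 2 * (η + η ^ 2) * ‖z₂‖ ^ 2 := by
  have h1 : ‖z₁ - c * z₂‖ ≤ ‖z₁‖ + ‖c‖ * ‖z₂‖ :=
    (norm_sub_le _ _).trans (by rw [norm_mul])
  have h2 : ‖z₁ - c * z₂‖ ^ 2 ≤ (‖z₁‖ + ‖c‖ * ‖z₂‖) ^ 2 :=
    pow_le_pow_left₀ (norm_nonneg _) h1 2
  have h3 : ‖c‖ * (‖z₁‖ * ‖z₂‖) ≤ K * η * (‖z₁‖ * ‖z₂‖) :=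
    mul_le_mul_of_nonneg_right hc (mul_nonneg (norm_nonneg _) (norm_nonneg _))
  have h4 : 0 ≤ η * (‖z₁‖ - K * ‖z₂‖) ^ 2 := mul_nonneg hη (sq_nonneg _)
  have h5 : ‖c‖ ^ 2 * ‖z₂‖ ^ 2 ≤ (K * η) ^ 2 * ‖z₂‖ ^ 2 :=
    mul_le_mul_of_nonneg_right (pow_le_pow_left₀ (norm_nonneg _) hc 2) (sq_nonneg _)
  nlinarith [h2, h3, h4, h5]

/-- The Young inequality `‖z₁ - c z₂‖² ≤ (1+η)‖z₁‖² + K²(η+η²)‖z₂‖²` read in `ℝ≥0∞`. [folklore] -/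
theorem coe_nnnorm_sub_mul_sq_le (z₁ z₂ c : ℂ) {K η : ℝ} (hη : 0 ≤ η) (hc : ‖c‖ ≤ K * η) :
    ((‖z₁ - c * z₂‖₊ : ℝ≥0∞)) ^ 2 ≤ ENNReal.ofReal (1 + η) * ((‖z₁‖₊ : ℝ≥0∞)) ^ 2 +
      ENNReal.ofReal (K ^ 2 * (η + η ^ 2)) * ((‖z₂‖₊ : ℝ≥0∞)) ^ 2 := by
  have hB : 0 ≤ K ^ 2 * (η + η ^ 2) := mul_nonneg (sq_nonneg _) (add_nonneg hη (sq_nonneg _))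
  have h1 : (0 : ℝ) ≤ 1 + η := by linarith
  -- `(‖z‖₊ : ℝ≥0∞)² = ofReal ‖z‖²` (`ennnorm_sq_eq_ofReal` of `DiluteBoseGasUpperBoundLocalization`)
  have e : ∀ z : ℂ, ((‖z‖₊ : ℝ≥0∞)) ^ 2 = ENNReal.ofReal (‖z‖ ^ 2) := fun z => by
    rw [ENNReal.ofReal_pow (norm_nonneg _), ofReal_norm, enorm_eq_nnnorm]
  rw [e, e z₁, e z₂, ← ENNReal.ofReal_mul h1, ← ENNReal.ofReal_mul hB,
    ← ENNReal.ofReal_add (mul_nonneg h1 (sq_nonneg _)) (mul_nonneg hB (sq_nonneg _))]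
  exact ENNReal.ofReal_le_ofReal (norm_sub_mul_sq_le z₁ z₂ c hη hc)

/-- Young inequality for the kinetic density: `|∇(φ - cψ)|² ≤ (1+η)|∇φ|² + K²(η+η²)|∇ψ|²`
pointwise, for differentiable `φ, ψ` and `‖c‖ ≤ Kη`. [folklore] -/
theorem kineticDensity_sub_mul_le {φ ψ : Config N → ℂ} (hφ : Differentiable ℝ φ)
    (hψ : Differentiable ℝ ψ) (c : ℂ) {K η : ℝ} (hη : 0 ≤ η) (hc : ‖c‖ ≤ K * η) (X : Config N) :
    kineticDensity (fun Y => φ Y - c * ψ Y) X ≤ ENNReal.ofReal (1 + η) * kineticDensity φ X +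
      ENNReal.ofReal (K ^ 2 * (η + η ^ 2)) * kineticDensity ψ X := by
  unfold kineticDensity
  have h1 : fderiv ℝ (fun Y => c * ψ Y) X = c • fderiv ℝ ψ X := fderiv_fun_const_smul (hψ X) c
  have h2 : fderiv ℝ (fun Y => φ Y - c * ψ Y) X = fderiv ℝ φ X - fderiv ℝ (fun Y => c * ψ Y) X :=
    fderiv_fun_sub (hφ X) ((hψ X).const_mul c)
  rw [h2, h1]
  simp only [FunLike.coe_sub, Pi.sub_apply, FunLike.coe_smul, Pi.smul_apply, smul_eq_mul,
    Finset.mul_sum, ← Finset.sum_add_distrib]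
  exact Finset.sum_le_sum fun i _ => Finset.sum_le_sum fun k _ =>
    coe_nnnorm_sub_mul_sq_le _ _ c hη hc

/-! ### Integrated Young inequalities on the cell -/

/-- Young inequality for the periodic energy of `F = φ - cψ` (`φ, ψ` of class `C¹`, `‖c‖ ≤ Kη`, any
measurable `v`, hard cores included): `q(φ - cψ) ≤ (1+η) q(φ) + K²(η+η²) q(ψ)`. [folklore] -/
theorem lintegral_energy_le_of_eq_sub (hv : Measurable v) (L : ℝ) {φ ψ F : Config N → ℂ}
    (hφ : ContDiff ℝ 1 φ) (hψ : ContDiff ℝ 1 ψ) {c : ℂ} {K η : ℝ} (hη : 0 ≤ η)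
    (hc : ‖c‖ ≤ K * η) (hF : ∀ X, F X = φ X - c * ψ X) :
    ∫⁻ X in cellN N L, kineticDensity F X + periodicInteraction v L X * ((‖F X‖₊ : ℝ≥0∞)) ^ 2 ≤
      ENNReal.ofReal (1 + η) * (∫⁻ X in cellN N L, kineticDensity φ X +
          periodicInteraction v L X * ((‖φ X‖₊ : ℝ≥0∞)) ^ 2) +
        ENNReal.ofReal (K ^ 2 * (η + η ^ 2)) * (∫⁻ X in cellN N L, kineticDensity ψ X +
          periodicInteraction v L X * ((‖ψ X‖₊ : ℝ≥0∞)) ^ 2) := by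
  obtain rfl : F = fun X => φ X - c * ψ X := funext hF
  rw [← lintegral_const_mul _ (measurable_energyIntegrand hv L hφ.continuous),
    ← lintegral_const_mul _ (measurable_energyIntegrand hv L hψ.continuous),
    ← lintegral_add_left ((measurable_energyIntegrand hv L hφ.continuous).const_mul _)]
  refine lintegral_mono fun X => ?_
  have hk := kineticDensity_sub_mul_le (hφ.differentiable one_ne_zero)
    (hψ.differentiable one_ne_zero) c hη hc X
  have hn := coe_nnnorm_sub_mul_sq_le (φ X) (ψ X) c hη hc
  calc kineticDensity (fun Y => φ Y - c * ψ Y) X +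
        periodicInteraction v L X * ((‖φ X - c * ψ X‖₊ : ℝ≥0∞)) ^ 2
      ≤ (ENNReal.ofReal (1 + η) * kineticDensity φ X +
          ENNReal.ofReal (K ^ 2 * (η + η ^ 2)) * kineticDensity ψ X) +
        periodicInteraction v L X * (ENNReal.ofReal (1 + η) * ((‖φ X‖₊ : ℝ≥0∞)) ^ 2 +
          ENNReal.ofReal (K ^ 2 * (η + η ^ 2)) * ((‖ψ X‖₊ : ℝ≥0∞)) ^ 2) :=
        add_le_add hk (mul_le_mul' le_rfl hn)
    _ = _ := by ring

/-- Young inequality for the cell mass of `F = φ + cψ` (`φ, ψ` continuous, `‖c‖ ≤ Kη`):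
`‖φ + cψ‖² ≤ (1+η)‖φ‖² + K²(η+η²)‖ψ‖²`. [folklore] -/
theorem lintegral_sq_le_of_eq_add (L : ℝ) {φ ψ F : Config N → ℂ} (hφ : Continuous φ)
    (hψ : Continuous ψ) {c : ℂ} {K η : ℝ} (hη : 0 ≤ η) (hc : ‖c‖ ≤ K * η)
    (hF : ∀ X, F X = φ X + c * ψ X) :
    ∫⁻ X in cellN N L, ((‖F X‖₊ : ℝ≥0∞)) ^ 2 ≤
      ENNReal.ofReal (1 + η) * (∫⁻ X in cellN N L, ((‖φ X‖₊ : ℝ≥0∞)) ^ 2) +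
        ENNReal.ofReal (K ^ 2 * (η + η ^ 2)) * ∫⁻ X in cellN N L, ((‖ψ X‖₊ : ℝ≥0∞)) ^ 2 := by
  obtain rfl : F = fun X => φ X + c * ψ X := funext hF
  rw [← lintegral_const_mul _ (measurable_coe_nnnorm_sq hφ),
    ← lintegral_const_mul _ (measurable_coe_nnnorm_sq hψ),
    ← lintegral_add_left ((measurable_coe_nnnorm_sq hφ).const_mul _)]
  refine lintegral_mono fun X => ?_
  have h := coe_nnnorm_sub_mul_sq_le (φ X) (ψ X) (-c) hη (by rwa [norm_neg])
  rwa [neg_mul, sub_neg_eq_add] at h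

/-! ### Energies of normalised multiples and the real bookkeeping -/

/-- The energy of a trial state `Ψ = a U`: `⟨Ψ, HΨ⟩ = |a|² q(U)`. [folklore] -/
theorem periodicEnergy_eq_of_eq_const_mul (v : ℝ → ℝ≥0∞) {U : Config N → ℂ} (hU : ContDiff ℝ 1 U)
    (Ψ : PeriodicTrialState N L) (a : ℝ) (h : Ψ.ψ = fun X => (a : ℂ) * U X) :
    periodicEnergy v Ψ = ((‖(a : ℂ)‖₊ : ℝ≥0∞)) ^ 2 * ∫⁻ X in cellN N L, kineticDensity U X +
        periodicInteraction v L X * ((‖U X‖₊ : ℝ≥0∞)) ^ 2 := by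
  unfold periodicEnergy; rw [h]; exact lintegral_periodicEnergy_const_mul v L (a : ℂ) hU

/-- **Real bookkeeping.** For `0 ≤ η ≤ 1/8` and `0 ≤ A ≤ (1-η)⁻¹` (`A = |a₁|²`), with
`j = 1 - η - A(η+η²)` (the numerator of the mass lower bound of `u₂ - ⟨Ψ₁,u₂⟩Ψ₁`): `j > 0` and the two
coefficient inequalities `(1-η)⁻¹ + (1+η)/j · A²(η+η²) ≤ 1 + 32η`, `(1+η)²/j ≤ 1 + 32η`. [folklore] -/
theorem real_bookkeeping {η A : ℝ} (hη0 : 0 ≤ η) (hη : η ≤ 1 / 8) (hA0 : 0 ≤ A)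
    (hA : A ≤ (1 - η)⁻¹) :
    0 < 1 - η - A * (η + η ^ 2) ∧
      (1 - η)⁻¹ + (1 + η) / (1 - η - A * (η + η ^ 2)) * (A ^ 2 * (η + η ^ 2)) ≤ 1 + 32 * η ∧
      (1 + η) / (1 - η - A * (η + η ^ 2)) * (1 + η) ≤ 1 + 32 * η := by
  have h1η : 0 < 1 - η := by linarith
  have hinv : (1 - η)⁻¹ ≤ 1 + 2 * η := by
    rw [inv_le_iff_one_le_mul₀ h1η]; nlinarith
  have hA2 : A ≤ 2 := hA.trans (hinv.trans (by linarith))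
  have hηη : η + η ^ 2 ≤ 9 / 8 * η := by nlinarith
  have hj : 1 / 2 ≤ 1 - η - A * (η + η ^ 2) := by
    have : A * (η + η ^ 2) ≤ 2 * (9 / 8 * η) :=
      mul_le_mul hA2 hηη (add_nonneg hη0 (sq_nonneg _)) zero_le_two
    linarith
  have hjpos : 0 < 1 - η - A * (η + η ^ 2) := by linarith
  refine ⟨hjpos, ?_, ?_⟩
  · have hT2 : (1 + η) / (1 - η - A * (η + η ^ 2)) ≤ 9 / 4 := by
      rw [div_le_iff₀ hjpos]; linarith
    have hT3 : A ^ 2 * (η + η ^ 2) ≤ 4 * (9 / 8 * η) :=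
      mul_le_mul (by nlinarith) hηη (add_nonneg hη0 (sq_nonneg _)) (by norm_num)
    have hT4 : (1 + η) / (1 - η - A * (η + η ^ 2)) * (A ^ 2 * (η + η ^ 2)) ≤
        9 / 4 * (4 * (9 / 8 * η)) :=
      mul_le_mul hT2 hT3 (mul_nonneg (sq_nonneg _) (add_nonneg hη0 (sq_nonneg _))) (by norm_num)
    linarith
  · rw [div_mul_eq_mul_div, div_le_iff₀ hjpos]
    have hpoly : 0 ≤ 27 - 99 * η - 64 * η ^ 2 := by nlinarith
    have hlow : (1 + 32 * η) * (1 - η - 2 * (η + η ^ 2)) ≤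
        (1 + 32 * η) * (1 - η - A * (η + η ^ 2)) := by
      have : A * (η + η ^ 2) ≤ 2 * (η + η ^ 2) :=
        mul_le_mul_of_nonneg_right hA2 (add_nonneg hη0 (sq_nonneg _))
      exact mul_le_mul_of_nonneg_left (by linarith) (by linarith)
    nlinarith [mul_nonneg hη0 hpoly]

/-- **Bookkeeping in `ℝ≥0∞`.** The final combination of the two normalised energies
`E₁ = I₁⁻¹ q₁`, `E₂ = J⁻¹ q_g` with `I₁⁻¹ ≤ (1-η)⁻¹`, `J⁻¹ ≤ (1+η)/j`,
`q_g ≤ (1+η) q₂ + A²(η+η²) q₁`: `E₁ + E₂ ≤ (1 + 32η)(q₁ + q₂)`. [folklore] -/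
theorem ennreal_bookkeeping {η A : ℝ} (hη0 : 0 ≤ η) (hη : η ≤ 1 / 8) (hA0 : 0 ≤ A)
    (hA : A ≤ (1 - η)⁻¹) {E₁ E₂ Iinv Jinv Q₁ Q₂ Qg : ℝ≥0∞} (hE₁ : E₁ = Iinv * Q₁)
    (hE₂ : E₂ = Jinv * Qg) (hI : Iinv ≤ ENNReal.ofReal (1 - η)⁻¹)
    (hJ : Jinv ≤ ENNReal.ofReal ((1 + η) / (1 - η - A * (η + η ^ 2))))
    (hQg : Qg ≤ ENNReal.ofReal (1 + η) * Q₂ + ENNReal.ofReal (A ^ 2 * (η + η ^ 2)) * Q₁) :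
    E₁ + E₂ ≤ ENNReal.ofReal (1 + 32 * η) * (Q₁ + Q₂) := by
  obtain ⟨hjpos, hR1, hR2⟩ := real_bookkeeping hη0 hη hA0 hA
  have h1η : 0 < 1 - η := by linarith
  have hc2 : 0 ≤ (1 + η) / (1 - η - A * (η + η ^ 2)) := div_nonneg (by linarith) hjpos.le
  have hB : 0 ≤ A ^ 2 * (η + η ^ 2) := mul_nonneg (sq_nonneg _) (add_nonneg hη0 (sq_nonneg _))
  calc E₁ + E₂ = Iinv * Q₁ + Jinv * Qg := by rw [hE₁, hE₂]
    _ ≤ ENNReal.ofReal (1 - η)⁻¹ * Q₁ + ENNReal.ofReal ((1 + η) / (1 - η - A * (η + η ^ 2))) *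
          (ENNReal.ofReal (1 + η) * Q₂ + ENNReal.ofReal (A ^ 2 * (η + η ^ 2)) * Q₁) :=
        add_le_add (mul_le_mul' hI le_rfl) (mul_le_mul' hJ hQg)
    _ = (ENNReal.ofReal (1 - η)⁻¹ + ENNReal.ofReal ((1 + η) / (1 - η - A * (η + η ^ 2))) *
            ENNReal.ofReal (A ^ 2 * (η + η ^ 2))) * Q₁ +
          (ENNReal.ofReal ((1 + η) / (1 - η - A * (η + η ^ 2))) * ENNReal.ofReal (1 + η)) *
            Q₂ := by ring
    _ ≤ ENNReal.ofReal (1 + 32 * η) * Q₁ + ENNReal.ofReal (1 + 32 * η) * Q₂ := by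
        gcongr
        · rw [← ENNReal.ofReal_mul hc2, ← ENNReal.ofReal_add (inv_nonneg.2 h1η.le)
            (mul_nonneg hc2 hB)]
          exact ENNReal.ofReal_le_ofReal hR1
        · rw [← ENNReal.ofReal_mul hc2]
          exact ENNReal.ofReal_le_ofReal hR2
    _ = ENNReal.ofReal (1 + 32 * η) * (Q₁ + Q₂) := (mul_add _ _ _).symm

end GramSchmidtPair

open GramSchmidtPair

/-- **Q1 `stub_gramSchmidtPair`** (Gram–Schmidt with energy control, every measurable pair potential `w`,
hard cores included). Two `C¹` periodic Bose-symmetric functions with masses in `[1-η, 1+η]` and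
overlap `≤ η ≤ 1/8` can be orthonormalised into two periodic trial states whose total `w`-energy is at
most `(1 + 32η)` times the total (unnormalised) `w`-energy of the given pair: `Ψ₁ = u₁/‖u₁‖`,
`Ψ₂ = (u₂ - ⟨Ψ₁,u₂⟩Ψ₁)/‖…‖`, division-free pointwise Young inequalities
`|a - cb|² ≤ (1+η)|a|² + K²(η+η²)|b|²` (`|c| ≤ Kη`) for values and gradients, the same inequality for
the mass of `u₂ - ⟨Ψ₁,u₂⟩Ψ₁` from below, scaling `q(cu) = |c|²q(u)`
(`lintegral_periodicEnergy_const_mul`), normalising constructor `exists_periodicTrialState_const_mul`.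
[folklore] -/
theorem stub_gramSchmidtPair :
    ∀ (w : ℝ → ℝ≥0∞), Measurable w → ∀ (N : ℕ) (L : ℝ), 0 < L → ∀ η : ℝ, 0 ≤ η → η ≤ 1 / 8 →
      ∀ u₁ u₂ : Config N → ℂ, ContDiff ℝ 1 u₁ → ContDiff ℝ 1 u₂ →
        (∀ (X : Config N) (i : Fin N) (k : Fin 3), u₁ (X + Pi.single i (EuclideanSpace.single k L)) = u₁ X) →
        (∀ (X : Config N) (i : Fin N) (k : Fin 3), u₂ (X + Pi.single i (EuclideanSpace.single k L)) = u₂ X) →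
        (∀ (σ : Equiv.Perm (Fin N)) (X : Config N), u₁ (X ∘ σ) = u₁ X) →
        (∀ (σ : Equiv.Perm (Fin N)) (X : Config N), u₂ (X ∘ σ) = u₂ X) →
        ENNReal.ofReal (1 - η) ≤ ∫⁻ X in cellN N L, ((‖u₁ X‖₊ : ℝ≥0∞)) ^ 2 →
        ∫⁻ X in cellN N L, ((‖u₁ X‖₊ : ℝ≥0∞)) ^ 2 ≤ ENNReal.ofReal (1 + η) →
        ENNReal.ofReal (1 - η) ≤ ∫⁻ X in cellN N L, ((‖u₂ X‖₊ : ℝ≥0∞)) ^ 2 →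
        ∫⁻ X in cellN N L, ((‖u₂ X‖₊ : ℝ≥0∞)) ^ 2 ≤ ENNReal.ofReal (1 + η) →
        ‖∫ X in cellN N L, conj (u₁ X) * u₂ X‖ ≤ η →
        ∃ Ψ₁ Ψ₂ : PeriodicTrialState N L, (∫ X in cellN N L, conj (Ψ₁.ψ X) * Ψ₂.ψ X = 0) ∧
          periodicEnergy w Ψ₁ + periodicEnergy w Ψ₂ ≤ ENNReal.ofReal (1 + 32 * η) *
            ((∫⁻ X in cellN N L, kineticDensity u₁ X + periodicInteraction w L X * ((‖u₁ X‖₊ : ℝ≥0∞)) ^ 2) +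
              ∫⁻ X in cellN N L, kineticDensity u₂ X + periodicInteraction w L X * ((‖u₂ X‖₊ : ℝ≥0∞)) ^ 2) := by
  intro w hw N L _hL η hη0 hη8 u₁ u₂ hu₁ hu₂ hper₁ hper₂ hsym₁ hsym₂ hI₁l hI₁u hI₂l hI₂u hs
  have h1η : 0 < 1 - η := by linarith
  have h1η' : 0 < 1 + η := by linarith
  -- Step 1: normalise `u₁`: `Ψ₁ = a₁ u₁`, `|a₁|² = I₁⁻¹ ≤ (1-η)⁻¹`
  have hI₁0 : (∫⁻ X in cellN N L, ((‖u₁ X‖₊ : ℝ≥0∞)) ^ 2) ≠ 0 :=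
    (lt_of_lt_of_le (ENNReal.ofReal_pos.2 h1η) hI₁l).ne'
  have hI₁t : (∫⁻ X in cellN N L, ((‖u₁ X‖₊ : ℝ≥0∞)) ^ 2) ≠ ⊤ :=
    ne_top_of_le_ne_top ENNReal.ofReal_ne_top hI₁u
  have hI₂t : (∫⁻ X in cellN N L, ((‖u₂ X‖₊ : ℝ≥0∞)) ^ 2) ≠ ⊤ :=
    ne_top_of_le_ne_top ENNReal.ofReal_ne_top hI₂u
  obtain ⟨Ψ₁, a₁, hΨ₁ψ, ha₁⟩ := exists_periodicTrialState_const_mul hu₁ hper₁ hsym₁ hI₁0 hI₁t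
  have hΨ₁X : ∀ X, Ψ₁.ψ X = (a₁ : ℂ) * u₁ X := fun X => by rw [hΨ₁ψ]
  have hΨ₁c : Continuous Ψ₁.ψ := Ψ₁.contDiff.continuous
  have hIinv : (∫⁻ X in cellN N L, ((‖u₁ X‖₊ : ℝ≥0∞)) ^ 2)⁻¹ ≤ ENNReal.ofReal (1 - η)⁻¹ := by
    rw [ENNReal.ofReal_inv_of_pos h1η]; exact ENNReal.inv_le_inv.2 hI₁l
  have hA : ‖(a₁ : ℂ)‖ ^ 2 ≤ (1 - η)⁻¹ := by
    have h : ENNReal.ofReal (‖(a₁ : ℂ)‖ ^ 2) ≤ ENNReal.ofReal (1 - η)⁻¹ := by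
      rw [ENNReal.ofReal_pow (norm_nonneg _), ofReal_norm, enorm_eq_nnnorm, ha₁]; exact hIinv
    exact (ENNReal.ofReal_le_ofReal_iff (inv_nonneg.2 h1η.le)).1 h
  -- Step 2: the overlap `α = ⟨Ψ₁, u₂⟩ = a₁ ⟨u₁, u₂⟩`, `|α| ≤ |a₁| η`
  set α : ℂ := ∫ X in cellN N L, conj (Ψ₁.ψ X) * u₂ X with hα_def
  have hα : α = (a₁ : ℂ) * ∫ X in cellN N L, conj (u₁ X) * u₂ X := by
    rw [hα_def, ← integral_const_mul]
    congr 1; funext X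
    rw [hΨ₁X, map_mul, Complex.conj_ofReal, mul_assoc]
  have hαn : ‖α‖ ≤ ‖(a₁ : ℂ)‖ * η := by
    rw [hα, norm_mul]; exact mul_le_mul_of_nonneg_left hs (norm_nonneg _)
  have hαa : ‖α * (a₁ : ℂ)‖ ≤ ‖(a₁ : ℂ)‖ ^ 2 * η := by
    rw [norm_mul]
    calc ‖α‖ * ‖(a₁ : ℂ)‖ ≤ ‖(a₁ : ℂ)‖ * η * ‖(a₁ : ℂ)‖ :=
        mul_le_mul_of_nonneg_right hαn (norm_nonneg _)
      _ = ‖(a₁ : ℂ)‖ ^ 2 * η := by ring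
  -- Step 3: `g = u₂ - α Ψ₁` is `C¹`, periodic, symmetric and orthogonal to `Ψ₁`
  obtain ⟨g, hg⟩ : ∃ g : Config N → ℂ, g = fun X => u₂ X - α * Ψ₁.ψ X := ⟨_, rfl⟩
  have hgX : ∀ X, g X = u₂ X - α * Ψ₁.ψ X := fun X => by rw [hg]
  have hgC : ContDiff ℝ 1 g := hg ▸ hu₂.sub (contDiff_const.mul Ψ₁.contDiff)
  have hgper : ∀ (X : Config N) (i : Fin N) (k : Fin 3),
      g (X + Pi.single i (EuclideanSpace.single k L)) = g X := fun X i k => by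
    rw [hgX, hgX, hper₂, Ψ₁.periodic]
  have hgsym : ∀ (σ : Equiv.Perm (Fin N)) (X : Config N), g (X ∘ σ) = g X := fun σ X => by
    rw [hgX, hgX, hsym₂, Ψ₁.symm]
  have horth_g : ∫ X in cellN N L, conj (Ψ₁.ψ X) * g X = 0 := by
    have hi1 : IntegrableOn (fun X => conj (Ψ₁.ψ X) * u₂ X) (cellN N L) :=
      integrableOn_cellN (hΨ₁c.star.mul hu₂.continuous) L
    have hi2 : IntegrableOn (fun X => α * (conj (Ψ₁.ψ X) * Ψ₁.ψ X)) (cellN N L) :=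
      integrableOn_cellN (continuous_const.mul (hΨ₁c.star.mul hΨ₁c)) L
    have hprod : (fun X => conj (Ψ₁.ψ X) * g X) =
        fun X => conj (Ψ₁.ψ X) * u₂ X - α * (conj (Ψ₁.ψ X) * Ψ₁.ψ X) := by
      funext X; rw [hgX]; ring
    rw [hprod, integral_sub hi1 hi2, integral_const_mul, integral_cellN_conj_mul_self_trialState,
      ← hα_def, mul_one, sub_self]
  -- Step 4: the mass `J = ‖g‖²` of `g`: `(1+η) J ≥ 1 - η - |a₁|²(η+η²)`, `J < ⊤`
  have hmass : (∫⁻ X in cellN N L, ((‖u₂ X‖₊ : ℝ≥0∞)) ^ 2) ≤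
      ENNReal.ofReal (1 + η) * (∫⁻ X in cellN N L, ((‖g X‖₊ : ℝ≥0∞)) ^ 2) +
        ENNReal.ofReal (‖(a₁ : ℂ)‖ ^ 2 * (η + η ^ 2)) := by
    have h := lintegral_sq_le_of_eq_add L hgC.continuous hΨ₁c hη0 hαn (F := u₂)
      (fun X => by rw [hgX]; ring)
    rwa [Ψ₁.norm_eq, mul_one] at h
  obtain ⟨hjpos, -, -⟩ := real_bookkeeping hη0 hη8 (sq_nonneg _) hA
  have hJl : ENNReal.ofReal ((1 - η - ‖(a₁ : ℂ)‖ ^ 2 * (η + η ^ 2)) / (1 + η)) ≤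
      ∫⁻ X in cellN N L, ((‖g X‖₊ : ℝ≥0∞)) ^ 2 := by
    rw [ENNReal.ofReal_div_of_pos h1η']
    refine ENNReal.div_le_of_le_mul ?_
    rw [ENNReal.ofReal_sub _ (mul_nonneg (sq_nonneg _) (add_nonneg hη0 (sq_nonneg _)))]
    exact tsub_le_iff_right.2 (hI₂l.trans (hmass.trans_eq (by rw [mul_comm (ENNReal.ofReal _)])))
  have hJ0 : (∫⁻ X in cellN N L, ((‖g X‖₊ : ℝ≥0∞)) ^ 2) ≠ 0 :=
    (lt_of_lt_of_le (ENNReal.ofReal_pos.2 (div_pos hjpos h1η')) hJl).ne'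
  have hJt : (∫⁻ X in cellN N L, ((‖g X‖₊ : ℝ≥0∞)) ^ 2) ≠ ⊤ := by
    have h := lintegral_sq_le_of_eq_add L hu₂.continuous hΨ₁c hη0 (K := ‖(a₁ : ℂ)‖)
      (by rwa [norm_neg]) (F := g) (c := -α) (fun X => by rw [hgX]; ring)
    rw [Ψ₁.norm_eq, mul_one] at h
    exact ne_top_of_le_ne_top (ENNReal.add_ne_top.2
      ⟨ENNReal.mul_ne_top ENNReal.ofReal_ne_top hI₂t, ENNReal.ofReal_ne_top⟩) h
  have hJinv : (∫⁻ X in cellN N L, ((‖g X‖₊ : ℝ≥0∞)) ^ 2)⁻¹ ≤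
      ENNReal.ofReal ((1 + η) / (1 - η - ‖(a₁ : ℂ)‖ ^ 2 * (η + η ^ 2))) := by
    rw [← inv_div, ENNReal.ofReal_inv_of_pos (div_pos hjpos h1η')]
    exact ENNReal.inv_le_inv.2 hJl
  -- Step 5: normalise `g`: `Ψ₂ = a₂ g`, orthogonal to `Ψ₁`
  obtain ⟨Ψ₂, a₂, hΨ₂ψ, ha₂⟩ := exists_periodicTrialState_const_mul hgC hgper hgsym hJ0 hJt
  have hΨ₂X : ∀ X, Ψ₂.ψ X = (a₂ : ℂ) * g X := fun X => by rw [hΨ₂ψ]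
  refine ⟨Ψ₁, Ψ₂, ?_, ?_⟩
  · have hprod : (fun X => conj (Ψ₁.ψ X) * Ψ₂.ψ X) = fun X => (a₂ : ℂ) * (conj (Ψ₁.ψ X) * g X) := by
      funext X; rw [hΨ₂X]; ring
    rw [hprod, integral_const_mul, horth_g, mul_zero]
  -- Step 6: energies: `E₁ = I₁⁻¹ q(u₁)`, `E₂ = J⁻¹ q(g)`, `q(g) ≤ (1+η) q(u₂) + |a₁|⁴(η+η²) q(u₁)`
  have hE₁ := periodicEnergy_eq_of_eq_const_mul w hu₁ Ψ₁ a₁ hΨ₁ψ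
  rw [ha₁] at hE₁
  have hE₂ := periodicEnergy_eq_of_eq_const_mul w hgC Ψ₂ a₂ hΨ₂ψ
  rw [ha₂] at hE₂
  have hqg := lintegral_energy_le_of_eq_sub hw L hu₂ hu₁ hη0 hαa (F := g)
    (fun X => by rw [hgX, hΨ₁X]; ring)
  exact ennreal_bookkeeping hη0 hη8 (sq_nonneg _) hA hE₁ hE₂ hIinv hJinv hqg

end Summit.AtomisticToContinuum.BoseEinsteinCondensation.Cruxes.HardCoreExtension.ThirdLawCurrentFloor

end
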